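import Mathlib

/-!
# SHARP glue: from the block bound `θ_n ≤ φ^{⌊n/L⌋}` to `θ_n ≤ e^{-cn}` (seat p4)

Kernel-checked twin of SHARP-p4-v3 Corollary S1′ (the no-prefactor form of P5, ROUTE-v4 §2.3), including
the `p = 0` case of the erratum (c5): a real sequence `a n` with `a n ≤ φ^{n / L}` (natural-number
division, `0 ≤ φ < 1`, `L ≥ 1`) and `a n ≤ b < 1` for all `n ≥ 1` satisfies `a n ≤ e^{-c n}` for all `n ≥ 1`,
for some `c > 0`. With `a n = θ_n(p)`, `φ = φ_p(S)`, `b = 1 − (1−p)^{2d}` (or `b = 0` when `p = 0`) this is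
exactly the paper argument. Abstract and measure-agnostic; no definitions.
-/

namespace Summit.Ventures.PercRepro0.Sharp

open Real

/-- `⌊n/L⌋ ≥ n/(2L)` for `n ≥ 2L` (natural-number division), as a real inequality. -/
theorem half_le_div_cast {n L : ℕ} (hL : 1 ≤ L) (hn : 2 * L ≤ n) :
    (n : ℝ) / (2 * L) ≤ ((n / L : ℕ) : ℝ) := by
  have h1 : L * (n / L) + n % L = n := Nat.div_add_mod n L
  have h2 : n % L < L := Nat.mod_lt n (by omega)
  have h3 : n ≤ 2 * (L * (n / L)) := by omega
  have hLpos : (0 : ℝ) < L := by exact_mod_cast (show 0 < L by omega)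
  rw [div_le_iff₀ (by positivity)]
  have h3' : (n : ℝ) ≤ 2 * (L * (n / L : ℕ)) := by exact_mod_cast h3
  linarith

/-- **Corollary S1′, abstract form.** -/
theorem exp_decay_of_block_bound (a : ℕ → ℝ) (φ b : ℝ) (L : ℕ) (hL : 1 ≤ L)
    (hφ0 : 0 ≤ φ) (hφ1 : φ < 1) (hb0 : 0 ≤ b) (hb1 : b < 1)
    (hfloor : ∀ n, a n ≤ φ ^ (n / L)) (hb : ∀ n, 1 ≤ n → a n ≤ b) :
    ∃ c : ℝ, 0 < c ∧ ∀ n : ℕ, 1 ≤ n → a n ≤ Real.exp (-(c * n)) := by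
  -- the case b = 0: a n = 0 for n ≥ 1
  rcases eq_or_lt_of_le hb0 with hb0' | hbpos
  · refine ⟨1, one_pos, fun n hn => ?_⟩
    have := hb n hn
    rw [← hb0'] at this
    exact le_trans this (Real.exp_pos _).le
  -- b ∈ (0,1): c″ := log(1/b)/(2L) handles 1 ≤ n < 2L
  have hLpos : (0 : ℝ) < L := by exact_mod_cast (show 0 < L by omega)
  set c'' : ℝ := Real.log (1 / b) / (2 * L) with hc''
  have hc''pos : 0 < c'' := by
    have : 0 < Real.log (1 / b) := Real.log_pos (by rw [lt_div_iff₀ hbpos]; linarith)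
    positivity
  have hsmall : ∀ n : ℕ, 1 ≤ n → n < 2 * L → a n ≤ Real.exp (-(c'' * n)) := by
    intro n hn hn2
    have hbn : b = Real.exp (-(c'' * (2 * L))) := by
      rw [hc'', div_mul_cancel₀ _ (by positivity), ← Real.log_inv, one_div, inv_inv, Real.exp_log hbpos]
    calc a n ≤ b := hb n hn
      _ = Real.exp (-(c'' * (2 * L))) := hbn
      _ ≤ Real.exp (-(c'' * n)) := by
        apply Real.exp_le_exp.mpr
        have : (n : ℝ) ≤ 2 * L := by exact_mod_cast hn2.le
        nlinarith
  -- the case φ = 0: a n = 0 for n ≥ L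
  rcases eq_or_lt_of_le hφ0 with hφ0' | hφpos
  · refine ⟨c'', hc''pos, fun n hn => ?_⟩
    rcases Nat.lt_or_ge n (2 * L) with hn2 | hn2
    · exact hsmall n hn hn2
    · have hk : 1 ≤ n / L := by
        rw [Nat.le_div_iff_mul_le (by omega)]; omega
      have : a n ≤ 0 := by
        have := hfloor n
        rw [← hφ0', zero_pow (by omega)] at this
        exact this
      exact le_trans this (Real.exp_pos _).le
  -- φ ∈ (0,1): c′ := log(1/φ)/(2L) handles n ≥ 2L
  set c' : ℝ := Real.log (1 / φ) / (2 * L) with hc'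
  have hc'pos : 0 < c' := by
    have : 0 < Real.log (1 / φ) := Real.log_pos (by rw [lt_div_iff₀ hφpos]; linarith)
    positivity
  have hlarge : ∀ n : ℕ, 2 * L ≤ n → a n ≤ Real.exp (-(c' * n)) := by
    intro n hn2
    have hk := half_le_div_cast hL hn2
    have hlogφ : Real.log φ < 0 := Real.log_neg hφpos hφ1
    calc a n ≤ φ ^ (n / L) := hfloor n
      _ = Real.exp (((n / L : ℕ) : ℝ) * Real.log φ) := by
        rw [Real.exp_nat_mul, Real.exp_log hφpos]
      _ ≤ Real.exp (((n : ℝ) / (2 * L)) * Real.log φ) := by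
        apply Real.exp_le_exp.mpr
        nlinarith
      _ = Real.exp (-(c' * n)) := by
        congr 1
        rw [hc', one_div, Real.log_inv]
        field_simp
  refine ⟨min c' c'', lt_min hc'pos hc''pos, fun n hn => ?_⟩
  have hmin1 : min c' c'' ≤ c' := min_le_left _ _
  have hmin2 : min c' c'' ≤ c'' := min_le_right _ _
  have hn0 : (0 : ℝ) ≤ n := by positivity
  rcases Nat.lt_or_ge n (2 * L) with hn2 | hn2
  · calc a n ≤ Real.exp (-(c'' * n)) := hsmall n hn hn2
      _ ≤ Real.exp (-(min c' c'' * n)) := by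
        apply Real.exp_le_exp.mpr
        nlinarith
  · calc a n ≤ Real.exp (-(c' * n)) := hlarge n hn2
      _ ≤ Real.exp (-(min c' c'' * n)) := by
        apply Real.exp_le_exp.mpr
        nlinarith

end Summit.Ventures.PercRepro0.Sharp
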